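import Summits.QuantumAdvantage.QuantumAdvantage.Theorems.WalkTwoStepSparsePinnedFibre

/-!
# Toward rung (G♯₂) `ThreeStepFreeRungFive` (item stmt-QuantumAdvantage-23286): THREE-STEP free-split forms — objects, evaluation, flip invariance

Cell qa-qnc0, route OddPrimeWalk, support item stmt-QuantumAdvantage-23286 (planner qa-qnc0-p2 g25, P2-25b: the sequel of the (G♯) item
stmt-QuantumAdvantage-23121, closed 2026-08-28 by `oddPrimeWalk_twoStepFreeRungFive`); prover qn-prover-3 g15.  First, engine-independent
file for the three-step class (cut `g` fires iff `α_g·#{i<s : u_i} + β_g·#{s≤i<t : u_i} + γ_g·#{i≥t : u_i} = r_g` in `ZMod p`, the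
item's explicit parametrisation `if i < s then α else if i < t then β else γ`):
* `ThreeStep`, `ThreeStep.y` (the played selection functions, literally the item's hypothesis shape), `threeStepSel_y`;
* `threeStepForm_eq`: the form equals `α·N(s) + β·(N(max s t) − N(s)) + γ·(W − N(max s t))` (covers `t < s`, where the middle piece is empty);
* `ThreeStep.y_eq_decide`: the fire bit as a decision on `(N(s), N(max s t), W)` mod `p`;
* `ThreeStep.y_cornerFlip`: a corner flip at a time different from both splits leaves the fire bit unchanged (the two-pin locality behind
  the planned engine: far cuts get BOTH splits pinned; co-observers of a flip at `τ` are the cuts with `s = τ` or `t = τ`);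
* `ThreeStep.ofTwoStep`, `y_ofTwoStep`: the two-step class embeds (`t := s`, `γ := β`).
WHAT THIS IS NOT: no regime statements, no engine; separation NOT moved.
-/

namespace Summit.QuantumAdvantage.AdviceFreeQNC0.LocalEngine

open Finset Classical

section ThreeStepForms

variable {p n : ℕ}

/-- Explicit data of a three-step free-split strategy: cut `g` tests `α_g·N(s_g) + β_g·(N(t_g) − N(s_g)) + γ_g·(W − N(t_g)) = r_g`
(pieces `i < s`, `s ≤ i < t`, `i ≥ t`). -/
structure ThreeStep (p n : ℕ) where
  s : Fin (n + 1) → ℕ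
  t : Fin (n + 1) → ℕ
  α : Fin (n + 1) → ZMod p
  β : Fin (n + 1) → ZMod p
  γ : Fin (n + 1) → ZMod p
  r : Fin (n + 1) → ZMod p

/-- The selection functions played by a three-step strategy (literally the shape of item 23286's hypothesis). -/
def ThreeStep.y (S : ThreeStep p n) : Fin (n + 1) → (Fin n → Bool) → Bool :=
  fun g u => decide ((univ.sum fun i : Fin n =>
    if u i then (if i.val < S.s g then S.α g else if i.val < S.t g then S.β g else S.γ g) else 0) = S.r g)

/-- The strategy `S.y` satisfies the item's three-step hypothesis. -/
theorem threeStepSel_y (S : ThreeStep p n) :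
    ∀ g, ∃ s t : ℕ, ∃ α β γ r : ZMod p, ∀ u, S.y g u = decide ((univ.sum fun i : Fin n =>
      if u i then (if i.val < s then α else if i.val < t then β else γ) else 0) = r) :=
  fun g => ⟨S.s g, S.t g, S.α g, S.β g, S.γ g, S.r g, fun _ => rfl⟩

/-- Conversely every strategy satisfying the hypothesis is some `S.y`. -/
theorem exists_threeStep_of_sel (y : Fin (n + 1) → (Fin n → Bool) → Bool)
    (hy : ∀ g, ∃ s t : ℕ, ∃ α β γ r : ZMod p, ∀ u, y g u = decide ((univ.sum fun i : Fin n =>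
      if u i then (if i.val < s then α else if i.val < t then β else γ) else 0) = r)) :
    ∃ S : ThreeStep p n, y = S.y := by
  choose s t α β γ r h using hy
  refine ⟨⟨s, t, α, β, γ, r⟩, ?_⟩
  funext g u
  rw [h g u]
  rfl

/-- `#{i : a ≤ i < b, u_i} = N(b) − N(a)` for `a ≤ b`, as a cast identity. -/
theorem card_band_eq (u : Fin n → Bool) {a b : ℕ} (hab : a ≤ b) :
    ((univ.filter fun i : Fin n => a ≤ i.val ∧ i.val < b ∧ u i = true).card : ℕ) + wtPrefix u a = wtPrefix u b := by
  unfold wtPrefix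
  rw [← Finset.card_union_of_disjoint]
  · congr 1
    ext i
    simp only [Finset.mem_union, Finset.mem_filter, Finset.mem_univ, true_and]
    constructor
    · rintro (⟨h1, h2, h3⟩ | ⟨h1, h2⟩)
      · exact ⟨h2, h3⟩
      · exact ⟨by omega, h2⟩
    · rintro ⟨h1, h2⟩
      by_cases ha : a ≤ i.val
      · exact Or.inl ⟨ha, h1, h2⟩
      · exact Or.inr ⟨by omega, h2⟩
  · rw [Finset.disjoint_filter]
    intro i _ h1 h2
    omega

/-- **Evaluation of the three-step form**: `α·N(s) + β·(N(m) − N(s)) + γ·(W − N(m))` with `m = max s t`. -/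
theorem threeStepForm_eq (u : Fin n → Bool) (s t : ℕ) (α β γ : ZMod p) :
    (∑ i : Fin n, if u i = true then (if i.val < s then α else if i.val < t then β else γ) else 0)
      = α * ((wtPrefix u s : ℕ) : ZMod p)
        + β * (((wtPrefix u (max s t) : ℕ) : ZMod p) - ((wtPrefix u s : ℕ) : ZMod p))
        + γ * (((wt u : ℕ) : ZMod p) - ((wtPrefix u (max s t) : ℕ) : ZMod p)) := by
  -- split the summand into the three bands
  have h1 : (∑ i : Fin n, if u i = true then (if i.val < s then α else if i.val < t then β else γ) else 0)
      = ∑ i : Fin n, ((if (i.val < s ∧ u i = true) then α else 0)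
          + (if (s ≤ i.val ∧ i.val < max s t ∧ u i = true) then β else 0)
          + (if (max s t ≤ i.val ∧ u i = true) then γ else 0)) := by
    refine Finset.sum_congr rfl fun i _ => ?_
    by_cases hu : u i = true
    · by_cases hs : i.val < s
      · have h2 : ¬ (s ≤ i.val ∧ i.val < max s t ∧ u i = true) := fun h => by omega
        have h3 : ¬ (max s t ≤ i.val ∧ u i = true) := fun h => by omega
        rw [if_pos hu, if_pos hs, if_pos ⟨hs, hu⟩, if_neg h2, if_neg h3]; ring
      · by_cases ht : i.val < t
        · have h1' : ¬ (i.val < s ∧ u i = true) := fun h => hs h.1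
          have h2 : (s ≤ i.val ∧ i.val < max s t ∧ u i = true) := ⟨by omega, by omega, hu⟩
          have h3 : ¬ (max s t ≤ i.val ∧ u i = true) := fun h => by omega
          rw [if_pos hu, if_neg hs, if_pos ht, if_neg h1', if_pos h2, if_neg h3]; ring
        · have h1' : ¬ (i.val < s ∧ u i = true) := fun h => hs h.1
          have h2 : ¬ (s ≤ i.val ∧ i.val < max s t ∧ u i = true) := fun h => by omega
          have h3 : (max s t ≤ i.val ∧ u i = true) := ⟨by omega, hu⟩
          rw [if_pos hu, if_neg hs, if_neg ht, if_neg h1', if_neg h2, if_pos h3]; ring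
    · have h1' : ¬ (i.val < s ∧ u i = true) := fun h => hu h.2
      have h2 : ¬ (s ≤ i.val ∧ i.val < max s t ∧ u i = true) := fun h => hu h.2.2
      have h3 : ¬ (max s t ≤ i.val ∧ u i = true) := fun h => hu h.2
      rw [if_neg hu, if_neg h1', if_neg h2, if_neg h3]; ring
  rw [h1, Finset.sum_add_distrib, Finset.sum_add_distrib, ← Finset.sum_filter, ← Finset.sum_filter, ← Finset.sum_filter,
    Finset.sum_const, Finset.sum_const, Finset.sum_const, nsmul_eq_mul, nsmul_eq_mul, nsmul_eq_mul]
  -- identify the three counts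
  have e1 : ((univ.filter fun i : Fin n => i.val < s ∧ u i = true).card : ℕ) = wtPrefix u s := rfl
  have e2 := card_band_eq u (le_max_left s t)
  have e3 : ((univ.filter fun i : Fin n => max s t ≤ i.val ∧ u i = true).card : ℕ) + wtPrefix u (max s t) = wt u := by
    have h := wt_eq_wtPrefix_add_card u (max s t); omega
  have e2' : (((univ.filter fun i : Fin n => s ≤ i.val ∧ i.val < max s t ∧ u i = true).card : ℕ) : ZMod p)
      = ((wtPrefix u (max s t) : ℕ) : ZMod p) - ((wtPrefix u s : ℕ) : ZMod p) := by
    rw [← e2, Nat.cast_add]; ring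
  have e3' : (((univ.filter fun i : Fin n => max s t ≤ i.val ∧ u i = true).card : ℕ) : ZMod p)
      = ((wt u : ℕ) : ZMod p) - ((wtPrefix u (max s t) : ℕ) : ZMod p) := by
    rw [← e3, Nat.cast_add]; ring
  rw [e1, e2', e3']
  ring

/-- The fire bit of cut `g` as a decision on `(N(s_g), N(max s_g t_g), W)`. -/
theorem ThreeStep.y_eq_decide (S : ThreeStep p n) (g : Fin (n + 1)) (u : Fin n → Bool) :
    S.y g u = decide (S.α g * ((wtPrefix u (S.s g) : ℕ) : ZMod p)
        + S.β g * (((wtPrefix u (max (S.s g) (S.t g)) : ℕ) : ZMod p) - ((wtPrefix u (S.s g) : ℕ) : ZMod p))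
        + S.γ g * (((wt u : ℕ) : ZMod p) - ((wtPrefix u (max (S.s g) (S.t g)) : ℕ) : ZMod p)) = S.r g) := by
  unfold ThreeStep.y
  rw [threeStepForm_eq]

/-- **Two-split locality**: a corner flip at a time different from both splits of cut `g` leaves its fire bit unchanged. -/
theorem ThreeStep.y_cornerFlip (S : ThreeStep p n) (τ : ℕ) (u : Fin n → Bool) (g : Fin (n + 1))
    (hs : S.s g ≠ τ) (ht : S.t g ≠ τ) : S.y g (cornerFlip n τ u) = S.y g u := by
  have hm : max (S.s g) (S.t g) ≠ τ := by
    rcases le_total (S.s g) (S.t g) with h | h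
    · rw [max_eq_right h]; exact ht
    · rw [max_eq_left h]; exact hs
  rw [ThreeStep.y_eq_decide, ThreeStep.y_eq_decide, wt_cornerFlip, wtPrefix_cornerFlip τ u hs, wtPrefix_cornerFlip τ u hm]

/-- The embedding of the two-step class: `t := s`, `γ := β`. -/
def ThreeStep.ofTwoStep (S : TwoStep p n) : ThreeStep p n :=
  ⟨S.s, S.s, S.α, S.β, S.β, S.r⟩

/-- The embedding plays the same selection functions. -/
theorem ThreeStep.y_ofTwoStep (S : TwoStep p n) : (ThreeStep.ofTwoStep S).y = S.y := by
  funext g u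
  unfold ThreeStep.y TwoStep.y ThreeStep.ofTwoStep
  simp only
  congr 2
  refine Finset.sum_congr rfl fun i _ => ?_
  by_cases hu : u i = true
  · by_cases hs : i.val < S.s g <;> simp [hu, hs]
  · simp [hu]

end ThreeStepForms

end Summit.QuantumAdvantage.AdviceFreeQNC0.LocalEngine
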